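import Mathlib
import Summits.KontsevichZagierPeriods.Zeta5Search.ThirdOrderTypes
import Summits.KontsevichZagierPeriods.Zeta5Search.SecondOrderRaise
import HarnessLib

/-!
# ζ(5) search — POLYNOMIAL FRAME FUNCTIONALS `σ_T[G·Φ_T]` (tools for gen-2 g13/g14's THEOREM L5, `SecondResidueLaw.LawA5`)

Cell `pub-zeta5` (HONEST FRAMING: systematic search; no irrationality claim unless certified), typer seat generation 13.
REPORT-gen2-g14 §2/§6 item (O)+(P): the fourth-order orbit lemma needs the first-digit functionals `ŵ`, `v̂` of the products
`G·Φ_T` for an ARBITRARY polynomial `G ∈ ℚ[η]` (the T-shape factor `P_x` times the cubic Taylor polynomial of the foreign factor),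
not only for `G ∈ {1, η, η²}` (`typeW/typeW2/typeW3`, typer g11/g12).  This file provides them at the level of exponent types
`T = (L, e)`:
* `polyAtLevel G i = G(i + ε)` as a power series; `frameRho L e G i σ = ρ[G·Φ_T]_{i,σ} = [ε^{n_i−σ}] G(i+ε)·G_i(ε)` (`G_i = typeProd`);
* `frameWPoly L e G = ŵ[G·Φ_T] = Σ_{poles i} ρ[GΦ_T]_{i,3}`, `frameVPoly L e G = v̂[G·Φ_T] = Σ_{i,σ} (−1)^σ ρ[GΦ_T]_{i,σ} H_i^{(σ)}`;
* LINEARITY in `G` (`frameRho_add/_C_mul/_sum`, same for `W`/`V`);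
* the MONOMIAL FORMULA `frameRho_X_pow` (`ρ[η^nΦ]_{i,σ} = Σ_m C(n,m) i^{n−m} ρ_{i,σ+m}`) and the identifications
  `typeW = ŵ[Φ_T]`, `typeW2 = ŵ[ηΦ_T]`, `typeW3 = ŵ[η²Φ_T]`, `typeTauW = ŵ[(2η−L)Φ_T]` (and `V`);
* (`p`-integrality of these functionals: `FourthOrderFrameNorms.lean`.)
Pure power-series algebra over `ℚ`; nothing here bears on irrationality.
-/

noncomputable section

open Finset PowerSeries

namespace Summit.KontsevichZagierPeriods.Zeta5Search.SecondOrder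

open Summit.KontsevichZagierPeriods.Zeta5Search.ClusterValuation
open Summit.KontsevichZagierPeriods.Zeta5Search.PadicSeries
open Summit.KontsevichZagierPeriods.Zeta5Search.LevelClass (typeRho typeW typeV)
open Literature.NumberTheory.Transcendental.BallRivoal (harm)

variable {p : ℕ} [hp : Fact p.Prime]

/-! ## §1 Definitions -/

/-- `G(i + ε)` as a formal power series in `ε`. -/
def polyAtLevel (G : Polynomial ℚ) (i : ℕ) : PowerSeries ℚ :=
  ((G.comp (Polynomial.X + Polynomial.C (i : ℚ)) : Polynomial ℚ) : PowerSeries ℚ)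

/-- `ρ[G·Φ_T]_{i,σ} := [ε^{n_i − σ}] (G(i+ε) · G_i(ε))` for `σ ≤ n_i = −e_i` (and `0` for `σ > n_i`): the coefficient of
`(η − i)^{−σ}` in the partial-fraction expansion of `G·Φ_T` at the level `i`. -/
def frameRho (L : ℕ) (e : ℕ → ℤ) (G : Polynomial ℚ) (i σ : ℕ) : ℚ :=
  if (σ : ℤ) ≤ -e i then coeff ((-e i).toNat - σ) (polyAtLevel G i * typeProd L e i) else 0

/-- `ŵ[G·Φ_T] := Σ_{poles i} ρ[GΦ_T]_{i,3}`. -/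
def frameWPoly (L : ℕ) (e : ℕ → ℤ) (G : Polynomial ℚ) : ℚ :=
  ∑ i ∈ (range (L + 1)).filter (fun i => e i < 0), frameRho L e G i 3

/-- `v̂[G·Φ_T] := Σ_{poles i} Σ_{σ=1}^{n_i} (−1)^σ ρ[GΦ_T]_{i,σ} H_i^{(σ)}`. -/
def frameVPoly (L : ℕ) (e : ℕ → ℤ) (G : Polynomial ℚ) : ℚ :=
  ∑ i ∈ (range (L + 1)).filter (fun i => e i < 0), ∑ σ ∈ Icc 1 (-e i).toNat,
    (-1 : ℚ) ^ σ * frameRho L e G i σ * harm σ i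

/-! ## §2 Linearity -/

omit hp in
/-- `polyAtLevel` is additive. -/
theorem polyAtLevel_add (G H : Polynomial ℚ) (i : ℕ) : polyAtLevel (G + H) i = polyAtLevel G i + polyAtLevel H i := by
  unfold polyAtLevel; rw [Polynomial.add_comp, Polynomial.coe_add]

omit hp in
/-- `polyAtLevel` commutes with scalars. -/
theorem polyAtLevel_C_mul (c : ℚ) (G : Polynomial ℚ) (i : ℕ) :
    polyAtLevel (Polynomial.C c * G) i = C c * polyAtLevel G i := by
  unfold polyAtLevel; rw [Polynomial.mul_comp, Polynomial.C_comp, Polynomial.coe_mul, Polynomial.coe_C]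

omit hp in
/-- `polyAtLevel` is multiplicative. -/
theorem polyAtLevel_mul (G H : Polynomial ℚ) (i : ℕ) : polyAtLevel (G * H) i = polyAtLevel G i * polyAtLevel H i := by
  unfold polyAtLevel; rw [Polynomial.mul_comp, Polynomial.coe_mul]

omit hp in
/-- `polyAtLevel 1 = 1`. -/
theorem polyAtLevel_one (i : ℕ) : polyAtLevel 1 i = 1 := by
  unfold polyAtLevel; rw [Polynomial.one_comp, Polynomial.coe_one]

omit hp in
/-- `polyAtLevel (X^n) i = (ε + i)^n`. -/
theorem polyAtLevel_X_pow (n i : ℕ) : polyAtLevel (Polynomial.X ^ n) i = (X + C (i : ℚ)) ^ n := by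
  unfold polyAtLevel
  rw [Polynomial.X_pow_comp, Polynomial.coe_pow, Polynomial.coe_add, Polynomial.coe_X, Polynomial.coe_C]

omit hp in
/-- `polyAtLevel X i = ε + i`. -/
theorem polyAtLevel_X (i : ℕ) : polyAtLevel Polynomial.X i = X + C (i : ℚ) := by
  rw [← pow_one Polynomial.X, polyAtLevel_X_pow, pow_one]

omit hp in
/-- `polyAtLevel (C c) i = C c`. -/
theorem polyAtLevel_C (c : ℚ) (i : ℕ) : polyAtLevel (Polynomial.C c) i = C c := by
  unfold polyAtLevel; rw [Polynomial.C_comp, Polynomial.coe_C]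

omit hp in
/-- `frameRho` is additive in `G`. -/
theorem frameRho_add (L : ℕ) (e : ℕ → ℤ) (G H : Polynomial ℚ) (i σ : ℕ) :
    frameRho L e (G + H) i σ = frameRho L e G i σ + frameRho L e H i σ := by
  unfold frameRho
  split_ifs
  · rw [polyAtLevel_add, add_mul, map_add]
  · rw [add_zero]

omit hp in
/-- `frameRho` commutes with scalars. -/
theorem frameRho_C_mul (L : ℕ) (e : ℕ → ℤ) (c : ℚ) (G : Polynomial ℚ) (i σ : ℕ) :
    frameRho L e (Polynomial.C c * G) i σ = c * frameRho L e G i σ := by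
  unfold frameRho
  split_ifs
  · rw [polyAtLevel_C_mul, mul_assoc, coeff_C_mul]
  · rw [mul_zero]

omit hp in
/-- `frameRho` of `0`. -/
theorem frameRho_zero (L : ℕ) (e : ℕ → ℤ) (i σ : ℕ) : frameRho L e 0 i σ = 0 := by
  have h := frameRho_C_mul L e 0 0 i σ
  rwa [zero_mul, map_zero, zero_mul] at h

omit hp in
/-- `frameRho` of a finite sum. -/
theorem frameRho_sum {ι : Type*} (L : ℕ) (e : ℕ → ℤ) (s : Finset ι) (G : ι → Polynomial ℚ) (i σ : ℕ) :
    frameRho L e (∑ k ∈ s, G k) i σ = ∑ k ∈ s, frameRho L e (G k) i σ := by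
  classical
  induction s using Finset.induction_on with
  | empty => rw [sum_empty, sum_empty, frameRho_zero]
  | insert a s ha ih => rw [sum_insert ha, sum_insert ha, frameRho_add, ih]

omit hp in
/-- `frameRho` of a difference. -/
theorem frameRho_sub (L : ℕ) (e : ℕ → ℤ) (G H : Polynomial ℚ) (i σ : ℕ) :
    frameRho L e (G - H) i σ = frameRho L e G i σ - frameRho L e H i σ := by
  have h := frameRho_add L e (G - H) H i σ
  rw [sub_add_cancel] at h
  linarith

omit hp in
/-- `ŵ[·Φ_T]` is additive. -/
theorem frameWPoly_add (L : ℕ) (e : ℕ → ℤ) (G H : Polynomial ℚ) :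
    frameWPoly L e (G + H) = frameWPoly L e G + frameWPoly L e H := by
  unfold frameWPoly; rw [← sum_add_distrib]; exact sum_congr rfl fun i _ => frameRho_add L e G H i 3

omit hp in
/-- `ŵ[·Φ_T]` commutes with scalars. -/
theorem frameWPoly_C_mul (L : ℕ) (e : ℕ → ℤ) (c : ℚ) (G : Polynomial ℚ) :
    frameWPoly L e (Polynomial.C c * G) = c * frameWPoly L e G := by
  unfold frameWPoly; rw [mul_sum]; exact sum_congr rfl fun i _ => frameRho_C_mul L e c G i 3

omit hp in
/-- `ŵ[·Φ_T]` of a difference. -/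
theorem frameWPoly_sub (L : ℕ) (e : ℕ → ℤ) (G H : Polynomial ℚ) :
    frameWPoly L e (G - H) = frameWPoly L e G - frameWPoly L e H := by
  unfold frameWPoly; rw [← sum_sub_distrib]; exact sum_congr rfl fun i _ => frameRho_sub L e G H i 3

omit hp in
/-- `ŵ[·Φ_T]` of a finite sum. -/
theorem frameWPoly_sum {ι : Type*} (L : ℕ) (e : ℕ → ℤ) (s : Finset ι) (G : ι → Polynomial ℚ) :
    frameWPoly L e (∑ k ∈ s, G k) = ∑ k ∈ s, frameWPoly L e (G k) := by
  unfold frameWPoly; rw [sum_comm]; exact sum_congr rfl fun i _ => frameRho_sum L e s G i 3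

omit hp in
/-- `v̂[·Φ_T]` is additive. -/
theorem frameVPoly_add (L : ℕ) (e : ℕ → ℤ) (G H : Polynomial ℚ) :
    frameVPoly L e (G + H) = frameVPoly L e G + frameVPoly L e H := by
  unfold frameVPoly; rw [← sum_add_distrib]
  refine sum_congr rfl fun i _ => ?_
  rw [← sum_add_distrib]
  exact sum_congr rfl fun σ _ => by rw [frameRho_add]; ring

omit hp in
/-- `v̂[·Φ_T]` commutes with scalars. -/
theorem frameVPoly_C_mul (L : ℕ) (e : ℕ → ℤ) (c : ℚ) (G : Polynomial ℚ) :
    frameVPoly L e (Polynomial.C c * G) = c * frameVPoly L e G := by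
  unfold frameVPoly; rw [mul_sum]
  refine sum_congr rfl fun i _ => ?_
  rw [mul_sum]
  exact sum_congr rfl fun σ _ => by rw [frameRho_C_mul]; ring

omit hp in
/-- `v̂[·Φ_T]` of a difference. -/
theorem frameVPoly_sub (L : ℕ) (e : ℕ → ℤ) (G H : Polynomial ℚ) :
    frameVPoly L e (G - H) = frameVPoly L e G - frameVPoly L e H := by
  have h := frameVPoly_add L e (G - H) H
  rw [sub_add_cancel] at h
  linarith

omit hp in
/-- `v̂[·Φ_T]` of a finite sum. -/
theorem frameVPoly_sum {ι : Type*} (L : ℕ) (e : ℕ → ℤ) (s : Finset ι) (G : ι → Polynomial ℚ) :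
    frameVPoly L e (∑ k ∈ s, G k) = ∑ k ∈ s, frameVPoly L e (G k) := by
  classical
  induction s using Finset.induction_on with
  | empty =>
    rw [sum_empty, sum_empty]
    unfold frameVPoly
    exact sum_eq_zero fun i _ => sum_eq_zero fun σ _ => by rw [frameRho_zero]; ring
  | insert a s ha ih => rw [sum_insert ha, sum_insert ha, frameVPoly_add, ih]

/-! ## §3 The monomial formula and the identification with `typeW`, `typeW2`, `typeW3`, `τ(T)` -/

omit hp in
/-- `[ε^k]((ε + c)^n · F) = Σ_{m ≤ n} C(n,m) c^{n−m} [ε^{k−m}]F` (terms with `m > k` absent). -/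
theorem coeff_linPow_mul (c : ℚ) (n k : ℕ) (F : PowerSeries ℚ) :
    coeff k ((X + C c) ^ n * F) =
      ∑ m ∈ range (n + 1), if m ≤ k then (n.choose m : ℚ) * c ^ (n - m) * coeff (k - m) F else 0 := by
  rw [add_pow, sum_mul, map_sum]
  refine sum_congr rfl fun m _ => ?_
  rw [show X ^ m * C c ^ (n - m) * (n.choose m : PowerSeries ℚ) * F =
      X ^ m * (C (c ^ (n - m) * (n.choose m : ℚ)) * F) by
    rw [map_mul, map_pow, map_natCast]; ring]
  rw [coeff_X_pow_mul', coeff_C_mul]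
  split_ifs <;> ring

omit hp in
/-- **Monomial formula**: `ρ[η^n Φ_T]_{i,σ} = Σ_{m=0}^{n} C(n,m) i^{n−m} ρ^T_{i,σ+m}` (terms with `σ + m > n_i` absent). -/
theorem frameRho_X_pow (L : ℕ) (e : ℕ → ℤ) (n i σ : ℕ) :
    frameRho L e (Polynomial.X ^ n) i σ =
      ∑ m ∈ range (n + 1), if (σ : ℤ) + m ≤ -e i then (n.choose m : ℚ) * (i : ℚ) ^ (n - m) * typeRho L e i (σ + m) else 0 := by
  unfold frameRho
  by_cases hσ : (σ : ℤ) ≤ -e i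
  · rw [if_pos hσ, polyAtLevel_X_pow, coeff_linPow_mul]
    refine sum_congr rfl fun m _ => ?_
    by_cases hm : (σ : ℤ) + m ≤ -e i
    · rw [if_pos (by omega), if_pos hm, typeRho_eq, show (-e i).toNat - σ - m = (-e i).toNat - (σ + m) by omega]
    · rw [if_neg (by omega), if_neg hm]
  · rw [if_neg hσ]
    exact (sum_eq_zero fun m _ => by rw [if_neg (by omega)]).symm

omit hp in
/-- `ρ[Φ_T]_{i,σ} = ρ^T_{i,σ}` (for `σ ≤ n_i`). -/
theorem frameRho_one (L : ℕ) (e : ℕ → ℤ) (i σ : ℕ) :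
    frameRho L e 1 i σ = if (σ : ℤ) ≤ -e i then typeRho L e i σ else 0 := by
  rw [← pow_zero Polynomial.X, frameRho_X_pow, sum_range_one]
  simp

omit hp in
/-- `ρ[ηΦ_T]_{i,σ} = i ρ_{i,σ} + ρ_{i,σ+1}[σ+1 ≤ n_i]`. -/
theorem frameRho_X (L : ℕ) (e : ℕ → ℤ) (i σ : ℕ) :
    frameRho L e Polynomial.X i σ =
      (if (σ : ℤ) ≤ -e i then (i : ℚ) * typeRho L e i σ else 0)
        + (if (σ : ℤ) + 1 ≤ -e i then typeRho L e i (σ + 1) else 0) := by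
  rw [← pow_one Polynomial.X, frameRho_X_pow, sum_range_succ, sum_range_one]
  simp only [Nat.choose_zero_right, Nat.cast_one, one_mul, Nat.sub_zero, pow_one, Nat.cast_zero, add_zero,
    Nat.choose_one_right, Nat.sub_self, pow_zero, mul_one]

omit hp in
/-- `ρ[η²Φ_T]_{i,σ} = i² ρ_{i,σ} + 2i ρ_{i,σ+1} + ρ_{i,σ+2}` (guards as usual). -/
theorem frameRho_X_sq (L : ℕ) (e : ℕ → ℤ) (i σ : ℕ) :
    frameRho L e (Polynomial.X ^ 2) i σ =
      (if (σ : ℤ) ≤ -e i then (i : ℚ) ^ 2 * typeRho L e i σ else 0)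
        + (if (σ : ℤ) + 1 ≤ -e i then 2 * (i : ℚ) * typeRho L e i (σ + 1) else 0)
        + (if (σ : ℤ) + 2 ≤ -e i then typeRho L e i (σ + 2) else 0) := by
  rw [frameRho_X_pow, sum_range_succ, sum_range_succ, sum_range_one]
  simp only [Nat.choose_zero_right, Nat.cast_one, one_mul, Nat.sub_zero, Nat.cast_zero, add_zero,
    show Nat.choose 2 1 = 2 from rfl, Nat.cast_ofNat, show 2 - 1 = 1 from rfl, pow_one, Nat.choose_self, Nat.sub_self,
    pow_zero, mul_one, Nat.cast_one]

omit hp in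
/-- **`ŵ(T) = ŵ[Φ_T]`.** -/
theorem typeW_eq_frameWPoly (L : ℕ) (e : ℕ → ℤ) : typeW L e = frameWPoly L e 1 := by
  unfold typeW frameWPoly
  refine sum_congr rfl fun i _ => ?_
  rw [frameRho_one]
  push_cast
  split_ifs <;> first | omega | rfl

omit hp in
/-- **`v̂(T) = v̂[Φ_T]`.** -/
theorem typeV_eq_frameVPoly (L : ℕ) (e : ℕ → ℤ) : typeV L e = frameVPoly L e 1 := by
  unfold typeV frameVPoly
  refine sum_congr rfl fun i hi => sum_congr rfl fun σ hσ => ?_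
  have hneg := (mem_filter.1 hi).2
  have h := (mem_Icc.1 hσ).2
  rw [frameRho_one, if_pos (by omega)]

omit hp in
/-- **`ŵ₂(T) = ŵ[ηΦ_T]`.** -/
theorem typeW2_eq_frameWPoly (L : ℕ) (e : ℕ → ℤ) : typeW2 L e = frameWPoly L e Polynomial.X := by
  unfold typeW2 frameWPoly
  refine sum_congr rfl fun i _ => ?_
  rw [frameRho_X]
  push_cast
  split_ifs <;> first | omega | rfl

omit hp in
/-- **`v̂₂(T) = v̂[ηΦ_T]`.** -/
theorem typeV2_eq_frameVPoly (L : ℕ) (e : ℕ → ℤ) : typeV2 L e = frameVPoly L e Polynomial.X := by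
  unfold typeV2 frameVPoly
  refine sum_congr rfl fun i hi => sum_congr rfl fun σ hσ => ?_
  have hneg := (mem_filter.1 hi).2
  have h := (mem_Icc.1 hσ).2
  have hσle : (σ : ℤ) ≤ -e i := by omega
  rw [frameRho_X, if_pos hσle]

omit hp in
/-- **`ŵ₃(T) = ŵ[η²Φ_T]`.** -/
theorem typeW3_eq_frameWPoly (L : ℕ) (e : ℕ → ℤ) : typeW3 L e = frameWPoly L e (Polynomial.X ^ 2) := by
  unfold typeW3 frameWPoly
  refine sum_congr rfl fun i _ => ?_
  rw [frameRho_X_sq]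
  push_cast
  split_ifs <;> first | omega | rfl

omit hp in
/-- **`v̂₃(T) = v̂[η²Φ_T]`.** -/
theorem typeV3_eq_frameVPoly (L : ℕ) (e : ℕ → ℤ) : typeV3 L e = frameVPoly L e (Polynomial.X ^ 2) := by
  unfold typeV3 frameVPoly
  refine sum_congr rfl fun i hi => sum_congr rfl fun σ hσ => ?_
  have hneg := (mem_filter.1 hi).2
  have h := (mem_Icc.1 hσ).2
  have hσle : (σ : ℤ) ≤ -e i := by omega
  rw [frameRho_X_sq, if_pos hσle]

omit hp in
/-- **`τ_W(T) = ŵ[(2η − L)Φ_T]`.** -/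
theorem typeTauW_eq_frameWPoly (L : ℕ) (e : ℕ → ℤ) :
    typeTauW L e = frameWPoly L e (Polynomial.C 2 * Polynomial.X - Polynomial.C (L : ℚ)) := by
  rw [typeTauW, frameWPoly_sub, frameWPoly_C_mul, ← typeW2_eq_frameWPoly, ← mul_one (Polynomial.C (L : ℚ)),
    frameWPoly_C_mul, ← typeW_eq_frameWPoly]

omit hp in
/-- **`τ_V(T) = v̂[(2η − L)Φ_T]`.** -/
theorem typeTauV_eq_frameVPoly (L : ℕ) (e : ℕ → ℤ) :
    typeTauV L e = frameVPoly L e (Polynomial.C 2 * Polynomial.X - Polynomial.C (L : ℚ)) := by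
  rw [typeTauV, frameVPoly_sub, frameVPoly_C_mul, ← typeV2_eq_frameVPoly, ← mul_one (Polynomial.C (L : ℚ)),
    frameVPoly_C_mul, ← typeV_eq_frameVPoly]

end Summit.KontsevichZagierPeriods.Zeta5Search.SecondOrder

end
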